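import Literature.MathematicalPhysics.QuantumLattice.UniformMagnetisationSpinFlipBound
import Literature.MathematicalPhysics.QuantumLattice.HubbardSiteNormsNumericCertificates
import Literature.MathematicalPhysics.QuantumLattice.FermionVariationalPrincipleBoxCertificates
import HarnessLib

/-!
# Spontaneous magnetisation of translation-invariant equilibrium states from two boxes: the fully numeric certificate

Uniform-field twin of `StaggeredOrderFromEvenBoxes` + `HubbardSiteNormsNumericCertificates`: for the Hubbard model in a chemical potential and a
uniform field, `hubbardZeeman d t U θ = Φ^{t,U} + θ₀ n + θ₁ s` (`θ = (−μ, −h)`):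

* §1 terms and NUMERIC site norms: all terms off singletons / nearest-neighbour bonds vanish, `‖Φ{y}‖ ≤ |U| + 2|θ₀| + 2|θ₁|`, `‖Φ{y,y+e_i}‖ ≤ 2|t|`,
  hence `Σ_{X ∋ x} ‖Φ X‖ ≤ |U| + 2|θ₀| + 2|θ₁| + 4d|t|` (`sum_norm_hubbardZeeman_le`); `Φ ∅ = 0`.
* §2 **END-TO-END**: for every translation-invariant equilibrium state `ω` of the ZERO-FIELD model (`θ = (a, 0)`, `β > 0`, `d ≥ 1`), every `δ > 0`,
  every box `[0,N)^d` (`N ≥ 1`, no parity condition) and certified `ℓ₀ ≤ log Re Z_N(a,0)`, `log Re Z_N(a,δ) ≤ u₁`: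
  `|ρ_↑(ω) − ρ_↓(ω)| ≤ ((u₁ − ℓ₀) + |β|((N+2)^d − N^d)(2|U| + 4|a| + 2δ + 8d|t|)) / (N^d βδ)`
  (`IsVarEquilibrium.abs_spinPolarisation_le_numeric`; the symbolic-site-norm form `…_of_boxes` and the two-number form `…_of_bounds` as well).

Everything is PROVED; no definition, no named fact, no number of record. HONEST SCOPE: at `h = 0` and `d ≤ 2` continuous-symmetry arguments give
more; here only the thermodynamic (Griffiths) bound is formalised, valid in every dimension.

## Tree / Mathlib search

REUSED: `hubbardZeeman(_structure)`, `IsVarEquilibrium.abs_spinPolarisation_le` (`UniformMagnetisationSpinFlipBound`); `sum_norm_le_of_nearestNeighbour`,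
pattern of `norm_hubbardStaggered_singleton_le` (`HubbardSiteNormsNumericCertificates`); `le_varPressure_of_le_log_partitionFn`, `varPressure_le_of_log_partitionFn_le`
(`FermionVariationalPrincipleBoxCertificates`); `hubbardFermionInteraction_apply_singleton/_pair/_eq_zero`, `numberInteraction_*`, `spinImbalanceInteraction_*`,
`norm_hoppingTerm_le_two_mul`, `orb_inj`, `norm_numberOp_le_one`, `card_thicken_halfOpenBox_sdiff_le`.

## References

* R. B. Griffiths, J. Math. Phys. 5 (1964) 1215, Eq. (39) and Fig. 3.
* T. Koma, H. Tasaki, Phys. Rev. Lett. 68 (1992) 3248, remark after eq. (11).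
* R. B. Israel, *Convexity in the Theory of Lattice Gases* (1979), Lemma II.3.1, Thm. I.2.4.
-/

noncomputable section

open scoped ComplexOrder BigOperators Matrix.Norms.L2Operator
open Finset Filter Topology

namespace Literature.MathematicalPhysics.QuantumLattice

open Matrix HubbardWave0 Literature.Probability.LatticeModels ThermodynamicLimit

variable {d : ℕ}

/-! ### §1. Terms and numeric site norms of `hubbardZeeman` -/

section Zeeman

variable (t U : ℝ) (θ : Fin 2 → ℝ)

/-- All terms off singletons and nearest-neighbour bonds vanish. [cite: arXiv9311033, §2 (the Hubbard Hamiltonian)] -/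
theorem hubbardZeeman_apply_eq_zero {X : Finset (Site d)} (h1 : ∀ y : Site d, X ≠ {y}) (h2 : ∀ (y : Site d) (i : Fin d), X ≠ {y, y + unitVec i}) :
    (hubbardZeeman d t U θ).Φ X = 0 := by
  rw [hubbardZeeman, FermionInteraction.linearFamily_apply, Fin.sum_univ_two, hubbardFermionInteraction_apply_eq_zero t U h1 h2,
    Matrix.cons_val_zero, Matrix.cons_val_one, Matrix.cons_val_zero, numberInteraction_apply_eq_zero h1, spinImbalanceInteraction_apply_eq_zero h1,
    smul_zero, smul_zero, add_zero, zero_add]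

/-- The model has no constant term: `Φ ∅ = 0`. [cite: ArakiMoriya2003, §5.1] -/
theorem hubbardZeeman_apply_empty : (hubbardZeeman d t U θ).Φ ∅ = 0 :=
  hubbardZeeman_apply_eq_zero t U θ (fun y h => absurd (h ▸ mem_singleton_self y) (Finset.notMem_empty y))
    (fun y _ h => absurd (h ▸ mem_insert_self y _) (Finset.notMem_empty y))

/-- The on-site term: `Φ{y} = U n↑n↓ + θ₀(n↑ + n↓) + θ₁(n↑ − n↓)`. [cite: arXiv9311033, §2 (the Hubbard Hamiltonian)] -/
theorem hubbardZeeman_apply_singleton (y : Site d) :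
    (hubbardZeeman d t U θ).Φ {y} =
      (U : ℂ) • (nAt y (mem_singleton_self y) 0 * nAt y (mem_singleton_self y) 1) +
        ((((θ 0 : ℝ) : ℂ) • (nAt y (mem_singleton_self y) 0 + nAt y (mem_singleton_self y) 1)) +
          ((θ 1 : ℝ) : ℂ) • (nAt y (mem_singleton_self y) 0 - nAt y (mem_singleton_self y) 1)) := by
  rw [hubbardZeeman, FermionInteraction.linearFamily_apply, Fin.sum_univ_two, hubbardFermionInteraction_apply_singleton,
    Matrix.cons_val_zero, Matrix.cons_val_one, Matrix.cons_val_zero, numberInteraction_apply_singleton, spinImbalanceInteraction_apply_singleton]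

/-- **On-site norm**: `‖Φ{y}‖ ≤ |U| + 2|θ₀| + 2|θ₁|`. [cite: KomaTasakiPRL1992, eq. (11) remark] -/
theorem norm_hubbardZeeman_singleton_le (y : Site d) : ‖(hubbardZeeman d t U θ).Φ {y}‖ ≤ |U| + 2 * |θ 0| + 2 * |θ 1| := by
  have hn : ∀ σ : Fin 2, ‖(nAt y (mem_singleton_self y) σ : FermionOp ({y} : Finset (Site d)))‖ ≤ 1 := fun σ => norm_numberOp_le_one _ _
  rw [hubbardZeeman_apply_singleton]
  set n0 : FermionOp ({y} : Finset (Site d)) := nAt y (mem_singleton_self y) 0 with hn0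
  set n1 : FermionOp ({y} : Finset (Site d)) := nAt y (mem_singleton_self y) 1 with hn1
  have h0 : ‖n0‖ ≤ 1 := hn 0
  have h1' : ‖n1‖ ≤ 1 := hn 1
  have hA : ‖(U : ℂ) • (n0 * n1)‖ ≤ |U| := by
    rw [norm_smul, Complex.norm_real, Real.norm_eq_abs]
    exact mul_le_of_le_one_right (abs_nonneg U) ((norm_mul_le _ _).trans (mul_le_one₀ h0 (norm_nonneg _) h1'))
  have hB : ‖((θ 0 : ℝ) : ℂ) • (n0 + n1)‖ ≤ 2 * |θ 0| := by
    rw [norm_smul, Complex.norm_real, Real.norm_eq_abs, mul_comm]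
    exact mul_le_mul_of_nonneg_right ((norm_add_le _ _).trans (by linarith)) (abs_nonneg _)
  have hC : ‖((θ 1 : ℝ) : ℂ) • (n0 - n1)‖ ≤ 2 * |θ 1| := by
    rw [norm_smul, Complex.norm_real, Real.norm_eq_abs, mul_comm]
    exact mul_le_mul_of_nonneg_right ((norm_sub_le _ _).trans (by linarith)) (abs_nonneg _)
  have hBC := norm_add_le (((θ 0 : ℝ) : ℂ) • (n0 + n1)) (((θ 1 : ℝ) : ℂ) • (n0 - n1))
  have hABC := norm_add_le ((U : ℂ) • (n0 * n1)) (((θ 0 : ℝ) : ℂ) • (n0 + n1) + ((θ 1 : ℝ) : ℂ) • (n0 - n1))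
  linarith

/-- Distinct sites give distinct orbitals of equal spin. [folklore] -/
private theorem orb_pt_ne'' {Λ : Finset (Site d)} {x y : Site d} (hx : x ∈ Λ) (hy : y ∈ Λ) (hxy : x ≠ y) (σ : Fin 2) :
    orb (PolySite.pt x hx) σ ≠ orb (PolySite.pt y hy) σ := by
  intro h
  have h1 := (orb_inj.1 h).1
  have h2 := congrArg (fun p : PolySite Λ => ofLex p.1) h1
  simp only [PolySite.ofLex_coe_pt] at h2
  exact hxy h2

/-- On bonds only the hopping survives. [cite: arXiv9311033, §2 (the Hubbard Hamiltonian)] -/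
theorem hubbardZeeman_apply_pair (y : Site d) (i : Fin d) :
    (hubbardZeeman d t U θ).Φ {y, y + unitVec i} = (hubbardFermionInteraction d t U).Φ {y, y + unitVec i} := by
  have hne : ∀ z : Site d, ({y, y + unitVec i} : Finset (Site d)) ≠ {z} := by
    intro z h
    have := congrArg Finset.card h
    rw [card_pair (self_ne_add_unitVec y i), card_singleton] at this
    exact absurd this (by norm_num)
  rw [hubbardZeeman, FermionInteraction.linearFamily_apply, Fin.sum_univ_two, Matrix.cons_val_zero, Matrix.cons_val_one, Matrix.cons_val_zero,
    numberInteraction_apply_eq_zero hne, spinImbalanceInteraction_apply_eq_zero hne, smul_zero, smul_zero, add_zero, add_zero]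

/-- **Bond norm**: `‖Φ{y, y+e_i}‖ ≤ 2|t|`. [cite: KomaTasakiPRL1992, eq. (11) remark] -/
theorem norm_hubbardZeeman_pair_le (y : Site d) (i : Fin d) : ‖(hubbardZeeman d t U θ).Φ {y, y + unitVec i}‖ ≤ 2 * |t| := by
  rw [hubbardZeeman_apply_pair, hubbardFermionInteraction_apply_pair]
  exact norm_hoppingTerm_le_two_mul t (fun σ => orb (PolySite.pt y (mem_insert_self _ _)) σ)
    (fun σ => orb (PolySite.pt (y + unitVec i) (mem_insert_of_mem (mem_singleton_self _))) σ)
    fun σ => orb_pt_ne'' _ _ (self_ne_add_unitVec y i) σ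

/-- **Numeric site norm**: `Σ_{X ⊆ T, x ∈ X} ‖Φ X‖ ≤ |U| + 2|θ₀| + 2|θ₁| + 4d|t|` (any region, any site). [cite: Israel1979, Lemma II.3.1] -/
theorem sum_norm_hubbardZeeman_le (T : Finset (Site d)) (x : Site d) :
    ∑ X ∈ T.powerset with x ∈ X, ‖(hubbardZeeman d t U θ).Φ X‖ ≤ |U| + 2 * |θ 0| + 2 * |θ 1| + 4 * d * |t| := by
  have h := sum_norm_le_of_nearestNeighbour (Ψ := hubbardZeeman d t U θ) (A := |U| + 2 * |θ 0| + 2 * |θ 1|) (B := 2 * |t|)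
    (by positivity) (by positivity) (fun X h1 h2 => hubbardZeeman_apply_eq_zero t U θ h1 h2) (norm_hubbardZeeman_singleton_le t U θ)
    (norm_hubbardZeeman_pair_le t U θ) T x
  linarith

end Zeeman

/-! ### §2. The spin polarisation of zero-field equilibrium states from two boxes -/

namespace InfVolFermionState

variable {β t U a : ℝ} {ω : InfVolFermionState d}

/-- **Two-number form**: `L₀ ≤ P(a,0)` and `P(a,δ) ≤ U₊` give `|ρ_↑ − ρ_↓| ≤ (U₊ − L₀)/(βδ)` for every zero-field TI equilibrium state
(`β > 0`, `δ > 0`, `R ≥ 1`, `d ≥ 1`). [cite: Griffiths1964, Eq. (39) and Fig. 3] -/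
theorem IsVarEquilibrium.abs_spinPolarisation_le_of_bounds (hd : 0 < d) (hβ : 0 < β) {R : ℝ} (hR : 1 ≤ R)
    (h : ω.IsVarEquilibrium β (hubbardZeeman d t U ![a, 0]) R) {δ : ℝ} (hδ : 0 < δ) {L₀ Uplus : ℝ}
    (hL : L₀ ≤ (hubbardZeeman d t U ![a, 0]).varPressure β R) (hU : (hubbardZeeman d t U ![a, δ]).varPressure β R ≤ Uplus) :
    |ω.meanEnergy (spinImbalanceInteraction d) R| ≤ (Uplus - L₀) / (β * δ) :=
  (h.abs_spinPolarisation_le hd hβ hR hδ).trans (div_le_div_of_nonneg_right (by linarith) (mul_pos hβ hδ).le)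

/-- **From two boxes** (symbolic site norms): `ℓ₀ ≤ log Re Z_N(a,0)`, `log Re Z_N(a,δ) ≤ u₁` on `[0,N)^d` (`N ≥ 1`) give
`|ρ_↑ − ρ_↓| ≤ ((u₁ − ℓ₀)/N^d + |β| col_1(N)(S₀ + S₁)/N^d)/(βδ)`, `S_j = Σ_{X ∋ 0, X ⊆ thicken_1{0}} ‖Φ_j X‖`.
[cite: Griffiths1964, Eq. (39) and Fig. 3] [cite: Israel1979, Lemma II.3.1] -/
theorem IsVarEquilibrium.abs_spinPolarisation_le_of_boxes (hd : 0 < d) (hβ : 0 < β)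
    (h : ω.IsVarEquilibrium β (hubbardZeeman d t U ![a, 0]) 1) {δ : ℝ} (hδ : 0 < δ) {N : ℕ} (hN : 1 ≤ N)
    {ℓ₀ u₁ : ℝ} (hℓ : ℓ₀ ≤ Real.log (Matrix.partitionFn β ((hubbardZeeman d t U ![a, 0]).localHamiltonian (halfOpenBox d N))).re)
    (hu : Real.log (Matrix.partitionFn β ((hubbardZeeman d t U ![a, δ]).localHamiltonian (halfOpenBox d N))).re ≤ u₁) :
    |ω.meanEnergy (spinImbalanceInteraction d) 1| ≤
      ((u₁ - ℓ₀) / (N : ℝ) ^ d +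
          |β| * ((((thicken (halfOpenBox d N) 1 \ halfOpenBox d N).card : ℝ)) *
              (∑ X ∈ (thicken ({0} : Finset (Site d)) 1).powerset with (0 : Site d) ∈ X, ‖(hubbardZeeman d t U ![a, 0]).Φ X‖ +
                ∑ X ∈ (thicken ({0} : Finset (Site d)) 1).powerset with (0 : Site d) ∈ X, ‖(hubbardZeeman d t U ![a, δ]).Φ X‖)) /
            (N : ℝ) ^ d) / (β * δ) := by
  obtain ⟨hH0, hE0, hT0, hR0⟩ := hubbardZeeman_structure (d := d) t U ![a, 0]
  obtain ⟨hH1, -, hT1, hR1⟩ := hubbardZeeman_structure (d := d) t U ![a, δ]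
  have hL := FermionInteraction.le_varPressure_of_le_log_partitionFn hd hH0 hE0 hT0 hR0 β hN hℓ
  have hU := FermionInteraction.varPressure_le_of_log_partitionFn_le hd hH1 hT1 hR1 β hN hu
  rw [hubbardZeeman_apply_empty, Matrix.zero_apply, Complex.zero_re, mul_zero, add_zero] at hL hU
  refine (h.abs_spinPolarisation_le_of_bounds hd hβ le_rfl hδ hL hU).trans (le_of_eq ?_)
  congr 1
  ring

/-- **FULLY NUMERIC MAGNETISATION CERTIFICATE**: for every translation-invariant equilibrium state `ω` of the zero-field Hubbard model
(`β > 0`, `d ≥ 1`), every `δ > 0`, every `N ≥ 1` and certified `ℓ₀ ≤ log Re Z_N(a,0)`, `log Re Z_N(a,δ) ≤ u₁`: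
`|ρ_↑(ω) − ρ_↓(ω)| ≤ ((u₁ − ℓ₀) + |β|((N+2)^d − N^d)(2|U| + 4|a| + 2δ + 8d|t|)) / (N^d βδ)`.
[cite: Griffiths1964, Eq. (39) and Fig. 3] [cite: Israel1979, Lemma II.3.1] -/
theorem IsVarEquilibrium.abs_spinPolarisation_le_numeric (hd : 0 < d) (hβ : 0 < β)
    (h : ω.IsVarEquilibrium β (hubbardZeeman d t U ![a, 0]) 1) {δ : ℝ} (hδ : 0 < δ) {N : ℕ} (hN : 1 ≤ N)
    {ℓ₀ u₁ : ℝ} (hℓ : ℓ₀ ≤ Real.log (Matrix.partitionFn β ((hubbardZeeman d t U ![a, 0]).localHamiltonian (halfOpenBox d N))).re)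
    (hu : Real.log (Matrix.partitionFn β ((hubbardZeeman d t U ![a, δ]).localHamiltonian (halfOpenBox d N))).re ≤ u₁) :
    |ω.meanEnergy (spinImbalanceInteraction d) 1| ≤
      ((u₁ - ℓ₀) + |β| * ((((N + 2) ^ d - N ^ d : ℕ) : ℝ) * (2 * |U| + 4 * |a| + 2 * δ + 8 * d * |t|))) / ((N : ℝ) ^ d * (β * δ)) := by
  have h0 := h.abs_spinPolarisation_le_of_boxes hd hβ hδ hN hℓ hu
  have hNd : (0 : ℝ) < (N : ℝ) ^ d := by positivity
  have hβδ : 0 < β * δ := mul_pos hβ hδ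
  have hcol : (((thicken (halfOpenBox d N) 1 \ halfOpenBox d N).card : ℕ) : ℝ) ≤ (((N + 2) ^ d - N ^ d : ℕ) : ℝ) := by
    have h1 := card_thicken_halfOpenBox_sdiff_le (d := d) N (1 : ℝ)
    rw [Nat.floor_one, mul_one] at h1
    exact_mod_cast h1
  have hS0 := sum_norm_hubbardZeeman_le (d := d) t U ![a, 0] (thicken ({0} : Finset (Site d)) 1) 0
  have hS1 := sum_norm_hubbardZeeman_le (d := d) t U ![a, δ] (thicken ({0} : Finset (Site d)) 1) 0
  simp only [Matrix.cons_val_zero, Matrix.cons_val_one, abs_zero, mul_zero, add_zero] at hS0 hS1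
  rw [abs_of_pos hδ] at hS1
  have hS0nn : 0 ≤ ∑ X ∈ (thicken ({0} : Finset (Site d)) 1).powerset with (0 : Site d) ∈ X, ‖(hubbardZeeman d t U ![a, 0]).Φ X‖ :=
    Finset.sum_nonneg fun X _ => norm_nonneg _
  have hS1nn : 0 ≤ ∑ X ∈ (thicken ({0} : Finset (Site d)) 1).powerset with (0 : Site d) ∈ X, ‖(hubbardZeeman d t U ![a, δ]).Φ X‖ :=
    Finset.sum_nonneg fun X _ => norm_nonneg _
  have hprod : (((thicken (halfOpenBox d N) 1 \ halfOpenBox d N).card : ℕ) : ℝ) *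
      (∑ X ∈ (thicken ({0} : Finset (Site d)) 1).powerset with (0 : Site d) ∈ X, ‖(hubbardZeeman d t U ![a, 0]).Φ X‖ +
        ∑ X ∈ (thicken ({0} : Finset (Site d)) 1).powerset with (0 : Site d) ∈ X, ‖(hubbardZeeman d t U ![a, δ]).Φ X‖) ≤
      (((N + 2) ^ d - N ^ d : ℕ) : ℝ) * (2 * |U| + 4 * |a| + 2 * δ + 8 * d * |t|) :=
    mul_le_mul hcol (by linarith) (add_nonneg hS0nn hS1nn) (Nat.cast_nonneg _)
  refine h0.trans ?_
  rw [← add_div, div_div]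
  refine div_le_div_of_nonneg_right ?_ (by positivity)
  have := mul_le_mul_of_nonneg_left hprod (abs_nonneg β)
  linarith

end InfVolFermionState

end Literature.MathematicalPhysics.QuantumLattice

end
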